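import Literature.AlgebraicGeometry.ModuliOfAbelianVarieties.SiegelFamilyHodgeGeneralIsogenyClasses
import Literature.Geometry.Kaehler.ComplexTorusAbelianThreefoldStablyNondegenerate
import Literature.Geometry.Kaehler.ComplexTorusAbelianSurfaceShimura
import HarnessLib

/-!
# The Hodge-group exceptional locus in low dimension: for `g ≤ 3`, `𝒩_Hg = {Z ∈ 𝔥_g | End_ℚ(X_Z) ≠ ℚ}` (Moonen–Zarhin:
# every abelian variety of dimension `≤ 3` satisfies (D), so Hodge-general ⟺ `End_ℚ = ℚ`); for `g = 2`,
# `𝒩_Hg = NL₂ = 𝒩_Hodge = ⋃_{Δ>0} H_Δ` (the Humbert surfaces): `Hg(X_Z) ≠ Sp₄ ⟺ ρ(X_Z) ≥ 2`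

Layer `Literature/AlgebraicGeometry/ModuliOfAbelianVarieties`, namespace
`Literature.AlgebraicGeometry.ModuliOfAbelianVarieties.SiegelModuli`; lane `lit-hodgefound` (Track 2, Layer A4), seat
`lit-hodgefound-skel-4`, row A4-133 of `run/shared/lean/pub/lit-hodgefound/SKELETON.md`. THEOREMS ONLY (no `def`, no
named fact, no instance, no notation; net debt `0`). Junction, consumed BY NAME, of row A4-132
(`SiegelFamilyHodgeGeneralIsogenyClasses`: `Z ∉ 𝒩_Hg ⟺ dim Hg(X_Z) = g(2g+1) ⟺` (D) `∧ End_ℚ(X_Z) = ℚ`, isogeny-saturation),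
p17's `ComplexTorusAbelianThreefoldStablyNondegenerate` (Moonen–Zarhin Thm. (0.1) (4) for `dim ≤ 3`:
`IsAbelianVariety.forall_divisorClasses_powPeriod_eq_hodgeClasses_of_finrank_le_three`), the Noether–Lefschetz / Humbert
files of the lane (`nlLocus`, `nonSimpleLocus`, `nlLocus_two_eq_hodgeExceptionalLocus`,
`nlLocus_two_eq_iUnion_humbertLocusOfInvariant`) and Shimura's table for simple abelian surfaces
(`IsSimple.finrank_endAlgRat_eq_one_of_finrank_neronSeveriGroup_eq_one`: simple with `ρ = 1 ⟹ End_ℚ = ℚ`).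

## Sources, verbatim

* B. Moonen, Yu. G. Zarhin, *Hodge classes on abelian varieties of low dimension*, Math. Ann. 315 (1999) [held
  `paper:arxiv-math_9901113`], §5 (5.2) (p0008 L107–L111): "for every complex abelian variety `X` of dimension `≤ 3` we have
  `Hg(X) = Sp_D(V,φ)` and condition (D) in (1.5) is satisfied"; §2 (2.2), (2.3) (p0005): type I(1), `End⁰(X) = ℚ ⟹ Hg(X) = Sp`.
* H. Lange, *Abelian Varieties over the Complex Numbers* (2023), §7.3.1 Prop. 7.3.2 (p. 336) ("For a general polarized abelian
  variety `(X, E)`, `Hg(X) = Sp(V, E)`"), §2.4.4 Cor. 2.4.26; §2.6.3 Exercise (2).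
* C. Birkenhake, H. Wilhelm, *Humbert surfaces and the Kummer plane*, Trans. AMS 355 (2003), §4 Prop. 4.9 (2) (`ρ ≥ 2` iff on a
  Humbert surface); S. Canning, D. Oprea, R. Pandharipande (2024), §1.9 Thm. 13 (the Noether–Lefschetz locus of `𝒜_g`).
* K. Hulek, R. Laface, *On the Picard numbers of abelian varieties* (2019), §5.1 Prop. 5.1 and §2.2 Prop. 2.4 (abelian surfaces:
  `ρ` versus `End_ℚ`).
* B. B. Gordon (1999), Thm. 7.5; B. van Geemen (1994), 3.6, 6.8.

## What is proved (`X_Z = prinPeriod Z`, `𝒩_Hg = hodgeGroupExceptionalLocus g`)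

* §1 `g ≤ 3`: **`not_mem_hodgeGroupExceptionalLocus_iff_endAlgRat_eq_bot_of_le_three`** (`Z ∉ 𝒩_Hg ⟺ End_ℚ(X_Z) = ℚ`),
  `mem_hodgeGroupExceptionalLocus_iff_endAlgRat_ne_bot_of_le_three`, **`hodgeGroupExceptionalLocus_eq_setOf_endAlgRat_ne_bot_of_le_three`**,
  `not_mem_hodgeGroupExceptionalLocus_iff_isSimple_and_endAlgRat_eq_bot_of_le_three`; for an ARBITRARY abelian variety `X` of
  dimension `≤ 3` (any universe, through an isogenous member of the principal family):
  `IsIsogenous.not_mem_hodgeGroupExceptionalLocus_iff_endAlgRat_eq_bot_of_le_three` (`X_Z ∼ X`: `Z ∉ 𝒩_Hg ⟺ End_ℚ(X) = ℚ`),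
  **`IsAbelianVariety.zdim_map_toGL_hodgeGroupC_eq_iff_endAlgRat_eq_bot_of_finrank_le_three`** (Hodge-general ⟺ `End_ℚ(X) = ℚ`),
  `IsAbelianVariety.forall_divisorClasses_powPeriod_eq_hodgeClasses_of_finrank_le_three_of_endAlgRat_eq_bot` (universe-polymorphic
  form of p17's universe-`0` theorem, under `End_ℚ = ℚ`).
* §2 `g = 2`: **`hodgeGroupExceptionalLocus_two_eq_nlLocus`** (`𝒩_Hg(2) = NL₂`: `Hg(X_Z) ≠ Sp(V, E_Z) ⟺ ρ(X_Z) ≥ 2`),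
  `hodgeGroupExceptionalLocus_two_eq_hodgeExceptionalLocus`, **`hodgeGroupExceptionalLocus_two_eq_iUnion_humbertLocusOfInvariant`**
  (`= ⋃_{Δ > 0} H_Δ(𝔥₂)`), `mem_hodgeGroupExceptionalLocus_two_iff_two_le_finrank_neronSeveriGroup`,
  `not_mem_hodgeGroupExceptionalLocus_two_iff_finrank_neronSeveriGroup_eq_one`, `finrank_neronSeveriGroup_prinPeriod_eq_one_iff_endAlgRat_eq_bot`;
  for an ARBITRARY abelian surface (any universe):
  **`IsAbelianVariety.zdim_map_toGL_hodgeGroupC_eq_iff_finrank_neronSeveriGroup_eq_one_of_finrank_eq_two`** (Hodge-general ⟺ `ρ = 1`),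
  `IsAbelianVariety.finrank_neronSeveriGroup_eq_one_iff_endAlgRat_eq_bot_of_finrank_eq_two` (`ρ = 1 ⟺ End_ℚ = ℚ`).

## References

* [MoonenZarhin1999LowDim] B. Moonen, Yu. G. Zarhin, Math. Ann. 315 (1999), Thm. (0.1) (4), §2 (2.2)–(2.3), §5 (5.2).
* [Lange2023AbelianVarietiesComplex] H. Lange, Springer (2023), §7.3.1 Prop. 7.3.2, §2.4.4 Cor. 2.4.26, §2.6.3 Exercise (2).
* [BirkenhakeWilhelm2003] C. Birkenhake, H. Wilhelm, Trans. AMS 355 (2003), §4 Prop. 4.9 (2).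
* [CanningOpreaPandharipande2024] S. Canning, D. Oprea, R. Pandharipande (2024), §1.9 Thm. 13.
* [HulekLaface2019PicardNumbersAV] K. Hulek, R. Laface, Ann. Sc. Norm. Super. Pisa (2019), §5.1 Prop. 5.1, §2.2 Prop. 2.4.
* [Gordon1999HodgeAVSurvey] B. B. Gordon (1999), Thm. 7.5. [vanGeemen1994HodgeAV] B. van Geemen (1994), 3.6, 6.8.
-/

noncomputable section

open Matrix Function Set Filter Module
open scoped Topology

namespace Literature.AlgebraicGeometry.ModuliOfAbelianVarieties

namespace SiegelModuli

open Literature.NumberTheory.Automorphic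
open Literature.Geometry.Kaehler Literature.Geometry.Kaehler.ComplexTorus

variable {g : ℕ}

/-- `dim_ℂ ℂ^g = g`. [folklore] -/
private theorem finrank_fin_fun₁₃₃ : finrank ℂ (Fin g → ℂ) = g := by
  rw [finrank_fintype_fun_eq_card, Fintype.card_fin]

/-- `Fin g ⊕ Fin g` is non-empty for `g ≥ 1`. [folklore] -/
private theorem nonempty_sum₁₃₃ (hg : 0 < g) : Nonempty (Fin g ⊕ Fin g) := ⟨Sum.inl ⟨0, hg⟩⟩

/-- For `g = 0`: `SL₀(ℝ)` is trivial, so `𝒩_Hg = ∅`, and `End_ℚ` of the zero torus is `⊥ = ⊤`. [folklore] -/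
private theorem not_mem_and_endAlgRat_eq_bot_of_eq_zero (hg : g = 0) (Z : siegelUpperHalfSpace g) :
    Z ∉ hodgeGroupExceptionalLocus g ∧ endAlgRat (prinPeriod Z) = ⊥ := by
  subst hg
  haveI : Subsingleton (Matrix.SpecialLinearGroup (Fin 0 ⊕ Fin 0) ℝ) :=
    ⟨fun A B ↦ Subtype.ext (Matrix.ext fun i _ ↦ (IsEmpty.false i).elim)⟩
  haveI : Subsingleton (Matrix (Fin 0 ⊕ Fin 0) (Fin 0 ⊕ Fin 0) ℚ) := ⟨fun A B ↦ Matrix.ext fun i _ ↦ (IsEmpty.false i).elim⟩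
  refine ⟨fun hZ ↦ (mem_hodgeGroupExceptionalLocus_iff.1 hZ) (Subsingleton.elim _ _), Subsingleton.elim _ _⟩

/-! ## §1 `g ≤ 3`: `𝒩_Hg = {Z | End_ℚ(X_Z) ≠ ℚ}` -/

section LeThree

/-- **`1 ≤ g ≤ 3`: `Z ∉ 𝒩_Hg ⟺ End_ℚ(X_Z) = ℚ`** — every abelian variety of dimension `≤ 3` satisfies (D) (Moonen–Zarhin), so
of Gordon's two conditions only `End_ℚ = ℚ` remains. [cite: MoonenZarhin1999LowDim, §5 (5.2) (p0008 L107–L111) and §2 (2.2)–(2.3)]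
[cite: Gordon1999HodgeAVSurvey, Thm. 7.5] [cite: Lange2023AbelianVarietiesComplex, §7.3.1 Prop. 7.3.2] -/
theorem not_mem_hodgeGroupExceptionalLocus_iff_endAlgRat_eq_bot_of_le_three (hg : g ≤ 3) (Z : siegelUpperHalfSpace g) :
    Z ∉ hodgeGroupExceptionalLocus g ↔ endAlgRat (prinPeriod Z) = ⊥ := by
  rcases Nat.eq_zero_or_pos g with h0 | h0
  · have h := not_mem_and_endAlgRat_eq_bot_of_eq_zero h0 Z
    exact ⟨fun _ ↦ h.2, fun _ ↦ h.1⟩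
  rw [not_mem_hodgeGroupExceptionalLocus_iff_forall_divisorClasses_and_endAlgRat_eq_bot]
  exact ⟨fun h ↦ h.2, fun h ↦ ⟨(isAbelianVariety_prinPeriod Z).forall_divisorClasses_powPeriod_eq_hodgeClasses_of_finrank_le_three
    (by rw [finrank_fin_fun₁₃₃]; exact h0) (by rw [finrank_fin_fun₁₃₃]; exact hg), h⟩⟩

/-- `g ≤ 3`: `Z ∈ 𝒩_Hg ⟺ End_ℚ(X_Z) ≠ ℚ`. [cite: MoonenZarhin1999LowDim, §5 (5.2)] [cite: Gordon1999HodgeAVSurvey, Thm. 7.5] -/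
theorem mem_hodgeGroupExceptionalLocus_iff_endAlgRat_ne_bot_of_le_three (hg : g ≤ 3) (Z : siegelUpperHalfSpace g) :
    Z ∈ hodgeGroupExceptionalLocus g ↔ endAlgRat (prinPeriod Z) ≠ ⊥ := by
  rw [Ne, ← not_mem_hodgeGroupExceptionalLocus_iff_endAlgRat_eq_bot_of_le_three hg Z, not_not]

/-- **`g ≤ 3`: `𝒩_Hg = {Z ∈ 𝔥_g | End_ℚ(X_Z) ≠ ℚ}`.** [cite: MoonenZarhin1999LowDim, §5 (5.2) and §2 (2.2)–(2.3)]
[cite: Lange2023AbelianVarietiesComplex, §7.3.1 Prop. 7.3.2] -/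
theorem hodgeGroupExceptionalLocus_eq_setOf_endAlgRat_ne_bot_of_le_three (hg : g ≤ 3) :
    hodgeGroupExceptionalLocus g = {Z | endAlgRat (prinPeriod Z) ≠ ⊥} :=
  Set.ext fun Z ↦ mem_hodgeGroupExceptionalLocus_iff_endAlgRat_ne_bot_of_le_three hg Z

/-- `1 ≤ g ≤ 3`: off `𝒩_Hg` exactly the `Z` with `X_Z` SIMPLE and `End_ℚ(X_Z) = ℚ` (type I(1) of Moonen–Zarhin §2).
[cite: MoonenZarhin1999LowDim, §2 (2.2)–(2.3)] [cite: Lange2023AbelianVarietiesComplex, §2.4.4 Cor. 2.4.26] -/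
theorem not_mem_hodgeGroupExceptionalLocus_iff_isSimple_and_endAlgRat_eq_bot_of_le_three (hg : g ≤ 3)
    (Z : siegelUpperHalfSpace g) :
    Z ∉ hodgeGroupExceptionalLocus g ↔ IsSimple (prinPeriod Z) ∧ endAlgRat (prinPeriod Z) = ⊥ := by
  rw [not_mem_hodgeGroupExceptionalLocus_iff_endAlgRat_eq_bot_of_le_three hg]
  exact ⟨fun h ↦ ⟨(isRiemannForm_prinForm Z).isSimple_of_endAlgRat_eq_bot h, h⟩, fun h ↦ h.2⟩

variable {ι : Type*} [Fintype ι] [DecidableEq ι] [Nonempty ι] {E : Type*} [NormedAddCommGroup E] [NormedSpace ℂ E]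
  [FiniteDimensional ℂ E] {Φ : (ι → ℝ) ≃L[ℝ] E}

/-- **For `X_Z ∼ X` with `dim X ≤ 3`: `Z ∉ 𝒩_Hg ⟺ End_ℚ(X) = ℚ`.** [cite: MoonenZarhin1999LowDim, §5 (5.2)]
[cite: Lange2023AbelianVarietiesComplex, §2.4.4 Cor. 2.4.26 and §7.3.1 Prop. 7.3.2] -/
theorem _root_.Literature.Geometry.Kaehler.ComplexTorus.IsIsogenous.not_mem_hodgeGroupExceptionalLocus_iff_endAlgRat_eq_bot_of_le_three
    (hg : g ≤ 3) {Z : siegelUpperHalfSpace g} (h : IsIsogenous (prinPeriod Z) Φ) :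
    Z ∉ hodgeGroupExceptionalLocus g ↔ endAlgRat Φ = ⊥ := by
  have hgE : finrank ℂ E = g := finrank_eq_of_isIsogenous_prinPeriod h
  have hg0 : 0 < g := by
    have h1 := card_eq_two_mul_finrank Φ
    have h2 : 0 < Fintype.card ι := Fintype.card_pos
    omega
  haveI := nonempty_sum₁₃₃ hg0
  rw [SiegelModuli.not_mem_hodgeGroupExceptionalLocus_iff_endAlgRat_eq_bot_of_le_three hg, h.endAlgRat_eq_bot_iff]

/-- **AN ABELIAN VARIETY OF DIMENSION `≤ 3` IS HODGE-GENERAL IFF `End_ℚ(X) = ℚ`** (`dim Hg(X) = g(2g+1) ⟺ End_ℚ(X) = ℚ`;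
any universe — read on an isogenous member of the principal Siegel family). [cite: MoonenZarhin1999LowDim, §5 (5.2) and §2 (2.2)–(2.3)]
[cite: Gordon1999HodgeAVSurvey, Thm. 7.5] [cite: vanGeemen1994HodgeAV, 3.6] -/
theorem _root_.Literature.Geometry.Kaehler.ComplexTorus.IsAbelianVariety.zdim_map_toGL_hodgeGroupC_eq_iff_endAlgRat_eq_bot_of_finrank_le_three
    (hX : IsAbelianVariety Φ) (h3 : finrank ℂ E ≤ 3) :
    (isZConnected_map_toGL_hodgeGroupC Φ).zdim = finrank ℂ E * (2 * finrank ℂ E + 1) ↔ endAlgRat Φ = ⊥ := by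
  obtain ⟨Z, hZ⟩ := exists_isIsogenous_prinPeriod_iff.2 ⟨hX, rfl⟩
  rw [← hZ.not_mem_hodgeGroupExceptionalLocus_iff_zdim_eq, hZ.not_mem_hodgeGroupExceptionalLocus_iff_endAlgRat_eq_bot_of_le_three h3]

/-- … hence for `dim X ≤ 3` and `End_ℚ(X) = ℚ`: (D) on all powers of `X`, in ANY universe (in universe `0` the hypothesis
`End_ℚ(X) = ℚ` is superfluous: p17's `IsAbelianVariety.forall_divisorClasses_powPeriod_eq_hodgeClasses_of_finrank_le_three`; here it
is transported from the universe-`0` model `X_Z` along `X_Z ∼ X`). [cite: MoonenZarhin1999LowDim, §5 (5.2)] [cite: Gordon1999HodgeAVSurvey, Thm. 7.5 and 7.6.1] -/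
theorem _root_.Literature.Geometry.Kaehler.ComplexTorus.IsAbelianVariety.forall_divisorClasses_powPeriod_eq_hodgeClasses_of_finrank_le_three_of_endAlgRat_eq_bot
    (hX : IsAbelianVariety Φ) (h3 : finrank ℂ E ≤ 3) (hE : endAlgRat Φ = ⊥) :
    ∀ k p : ℕ, divisorClasses (powPeriod Φ k) p = hodgeClasses (powPeriod Φ k) p :=
  ((hX.zdim_map_toGL_hodgeGroupC_eq_iff Φ).1 ((hX.zdim_map_toGL_hodgeGroupC_eq_iff_endAlgRat_eq_bot_of_finrank_le_three h3).2 hE)).1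

end LeThree

/-! ## §2 `g = 2`: `𝒩_Hg = NL₂ = 𝒩_Hodge = ⋃_{Δ > 0} H_Δ` -/

section Two

/-- **`𝒩_Hg(2) = NL₂`: a principally polarised abelian surface has `Hg(X_Z) ≠ Sp(V, E_Z)` iff `ρ(X_Z) ≥ 2`** —
`⊇`: `NL₂ ⊆ 𝒩_Hodge ⊆ 𝒩_Hg` (rows A4-56/57); `⊆`: off `NL₂` the surface `X_Z` is simple (a non-simple one has `ρ ≥ 2`)
with `ρ = 1`, so `End_ℚ(X_Z) = ℚ` by Shimura's table, and every abelian surface satisfies (D).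
[cite: BirkenhakeWilhelm2003, §4 Prop. 4.9 (2)] [cite: HulekLaface2019PicardNumbersAV, §5.1 Prop. 5.1 and §2.2 Prop. 2.4]
[cite: MoonenZarhin1999LowDim, §5 (5.2)] [cite: Lange2023AbelianVarietiesComplex, §7.3.1 Prop. 7.3.2] -/
theorem hodgeGroupExceptionalLocus_two_eq_nlLocus : hodgeGroupExceptionalLocus 2 = nlLocus 2 := by
  refine le_antisymm (fun Z hZ ↦ ?_)
    (nlLocus_subset_hodgeExceptionalLocus.trans hodgeExceptionalLocus_subset_hodgeGroupExceptionalLocus)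
  by_contra hnl
  have hsimple : IsSimple (prinPeriod Z) := by
    by_contra hns
    exact hnl (nonSimpleLocus_subset_nlLocus (mem_nonSimpleLocus_iff.2 hns))
  have hρ : finrank ℤ (neronSeveriGroup (prinPeriod Z)) = 1 := by
    have h1 : Z ∈ nlLocusRank 2 1 := by
      rw [← compl_nlLocus_eq_nlLocusRank_one (by norm_num : 0 < 2)]
      exact hnl
    exact mem_nlLocusRank_iff_finrank_neronSeveriGroup.1 h1
  have hE : endAlgRat (prinPeriod Z) = ⊥ :=
    Subalgebra.eq_bot_of_finrank_one
      (hsimple.finrank_endAlgRat_eq_one_of_finrank_neronSeveriGroup_eq_one (isRiemannForm_prinForm Z) finrank_fin_fun₁₃₃ hρ)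
  exact (mem_hodgeGroupExceptionalLocus_iff_endAlgRat_ne_bot_of_le_three (by norm_num) Z).1 hZ hE

/-- `𝒩_Hg(2) = 𝒩_Hodge(2)` (the Hodge-locus exceptional set of row A4-56). [cite: Lange2023AbelianVarietiesComplex, §7.3.1 Prop. 7.3.2 and §7.3.2 Thm. 7.3.4]
[cite: BirkenhakeWilhelm2003, §4 Prop. 4.9 (2)] -/
theorem hodgeGroupExceptionalLocus_two_eq_hodgeExceptionalLocus : hodgeGroupExceptionalLocus 2 = hodgeExceptionalLocus 2 := by
  rw [hodgeGroupExceptionalLocus_two_eq_nlLocus, nlLocus_two_eq_hodgeExceptionalLocus]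

/-- **`𝒩_Hg(2) = ⋃_{Δ > 0} H_Δ(𝔥₂)`: the principally polarised abelian surfaces with `Hg ≠ Sp₄` are exactly those on a
Humbert surface.** [cite: BirkenhakeWilhelm2003, §4 Prop. 4.9 (2) (p. 1831)] [cite: CanningOpreaPandharipande2024, §1.9 Thm. 13]
[cite: Lange2023AbelianVarietiesComplex, §7.3.1 Prop. 7.3.2] -/
theorem hodgeGroupExceptionalLocus_two_eq_iUnion_humbertLocusOfInvariant :
    hodgeGroupExceptionalLocus 2 = ⋃ (Δ : ℤ) (_ : 0 < Δ), humbertLocusOfInvariant Δ := by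
  rw [hodgeGroupExceptionalLocus_two_eq_nlLocus, nlLocus_two_eq_iUnion_humbertLocusOfInvariant]

/-- `Hg(X_Z) ≠ Sp(V, E_Z) ⟺ ρ(X_Z) ≥ 2` (`g = 2`). [cite: BirkenhakeWilhelm2003, §4 Prop. 4.9 (2)] [cite: HulekLaface2019PicardNumbersAV, §5.1 Prop. 5.1] -/
theorem mem_hodgeGroupExceptionalLocus_two_iff_two_le_finrank_neronSeveriGroup (Z : siegelUpperHalfSpace 2) :
    Z ∈ hodgeGroupExceptionalLocus 2 ↔ 2 ≤ finrank ℤ (neronSeveriGroup (prinPeriod Z)) := by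
  rw [hodgeGroupExceptionalLocus_two_eq_nlLocus, mem_nlLocus_iff_finrank_neronSeveriGroup]

/-- `Hg(X_Z) = Sp(V, E_Z) ⟺ ρ(X_Z) = 1` (`g = 2`). [cite: BirkenhakeWilhelm2003, §4 Prop. 4.9 (2)] [cite: HulekLaface2019PicardNumbersAV, §5.1 Prop. 5.1] -/
theorem not_mem_hodgeGroupExceptionalLocus_two_iff_finrank_neronSeveriGroup_eq_one (Z : siegelUpperHalfSpace 2) :
    Z ∉ hodgeGroupExceptionalLocus 2 ↔ finrank ℤ (neronSeveriGroup (prinPeriod Z)) = 1 := by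
  rw [hodgeGroupExceptionalLocus_two_eq_nlLocus, ← mem_compl_iff, compl_nlLocus_eq_nlLocusRank_one (by norm_num : 0 < 2),
    mem_nlLocusRank_iff_finrank_neronSeveriGroup]

/-- `Hg(X_Z) = Sp(V, E_Z) ⟺ ρ(X_Z) = 1 ⟺ End_ℚ(X_Z) = ℚ` (`g = 2`). [cite: HulekLaface2019PicardNumbersAV, §5.1 Prop. 5.1 and §2.2 Prop. 2.4]
[cite: MoonenZarhin1999LowDim, §2 (2.2)] -/
theorem finrank_neronSeveriGroup_prinPeriod_eq_one_iff_endAlgRat_eq_bot (Z : siegelUpperHalfSpace 2) :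
    finrank ℤ (neronSeveriGroup (prinPeriod Z)) = 1 ↔ endAlgRat (prinPeriod Z) = ⊥ := by
  rw [← not_mem_hodgeGroupExceptionalLocus_two_iff_finrank_neronSeveriGroup_eq_one,
    not_mem_hodgeGroupExceptionalLocus_iff_endAlgRat_eq_bot_of_le_three (by norm_num)]

variable {ι : Type*} [Fintype ι] [DecidableEq ι] [Nonempty ι] {E : Type*} [NormedAddCommGroup E] [NormedSpace ℂ E]
  [FiniteDimensional ℂ E] {Φ : (ι → ℝ) ≃L[ℝ] E}

/-- **AN ABELIAN SURFACE IS HODGE-GENERAL IFF `ρ = 1`** (`dim Hg(X) = 10 ⟺ ρ(X) = 1`; any universe — `ρ` and `dim Hg` are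
isogeny invariants, read on an isogenous `X_Z`, `Z ∈ 𝔥₂`). [cite: BirkenhakeWilhelm2003, §4 Prop. 4.9 (2)]
[cite: HulekLaface2019PicardNumbersAV, §5.1 Prop. 5.1 and §2.2 Prop. 2.4] [cite: vanGeemen1994HodgeAV, 3.6] -/
theorem _root_.Literature.Geometry.Kaehler.ComplexTorus.IsAbelianVariety.zdim_map_toGL_hodgeGroupC_eq_iff_finrank_neronSeveriGroup_eq_one_of_finrank_eq_two
    (hX : IsAbelianVariety Φ) (h2 : finrank ℂ E = 2) :
    (isZConnected_map_toGL_hodgeGroupC Φ).zdim = 10 ↔ finrank ℤ (neronSeveriGroup Φ) = 1 := by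
  obtain ⟨Z, hZ⟩ := exists_isIsogenous_prinPeriod_iff.2 ⟨hX, h2⟩
  have h := hZ.not_mem_hodgeGroupExceptionalLocus_iff_zdim_eq
  rw [h2] at h
  rw [show (10 : ℕ) = 2 * (2 * 2 + 1) by norm_num, ← h, not_mem_hodgeGroupExceptionalLocus_two_iff_finrank_neronSeveriGroup_eq_one,
    hZ.finrank_neronSeveriGroup_eq _ _]

/-- An abelian surface: `ρ(X) = 1 ⟺ End_ℚ(X) = ℚ` (any universe). [cite: HulekLaface2019PicardNumbersAV, §5.1 Prop. 5.1 and §2.2 Prop. 2.4] -/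
theorem _root_.Literature.Geometry.Kaehler.ComplexTorus.IsAbelianVariety.finrank_neronSeveriGroup_eq_one_iff_endAlgRat_eq_bot_of_finrank_eq_two
    (hX : IsAbelianVariety Φ) (h2 : finrank ℂ E = 2) : finrank ℤ (neronSeveriGroup Φ) = 1 ↔ endAlgRat Φ = ⊥ := by
  rw [← hX.zdim_map_toGL_hodgeGroupC_eq_iff_finrank_neronSeveriGroup_eq_one_of_finrank_eq_two h2,
    show (10 : ℕ) = finrank ℂ E * (2 * finrank ℂ E + 1) by rw [h2],
    hX.zdim_map_toGL_hodgeGroupC_eq_iff_endAlgRat_eq_bot_of_finrank_le_three (by rw [h2]; norm_num)]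

end Two

end SiegelModuli

end Literature.AlgebraicGeometry.ModuliOfAbelianVarieties

end
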